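import Summits.AtomisticToContinuum.Crystallization.Theorems.FrustratedLawDichotomyStrainedPatchStrainBands

/-!
# The envelope engine made parametric in the CHART FAMILY, the ENVELOPE MODULUS and the ROOM LAW; bent (two-scale) charts («ChartFamilies», lens-5 g51)

Lens-5 («finite / base range + asymptotic regime + bridge») node under «StrainBands» (g50) on the 27623 T-side piece `StrainedPatchRec`.
TARGET OF RECORD (critic ROWS 849 (d) / 867 / 880 / 886): `CoreOffTubeFloor (63/10) (63/10) (24/5) (1/100) φ₁` **[CORE-FAR]**, cut by g50 into
`EdgeFarFloor … η₂ φ₁` (engine (E1) ∧ (E2) ∧ (E3)) and the residual of record `SoftFarFloor (63/10) (63/10) (24/5) (1/100) (1/10) 0` **[SOFT-FAR]**.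

This node answers the two flags of critic ROW 886 on the edge engine.

FLAG-1 (§1, XS).  `SlavedEnvelopeAt η₃ τ ℓ s q` := (E1) restricted to charts by `η₃`-GOOD admissible homogeneous instances (the linearly STABLE range,
below the instability onset `η*`; (E2) already delivers `η₃`-good charts).  `SlavedEnvelope τ ℓ s q → SlavedEnvelopeAt η₃ τ ℓ s q`, antitone in `η₃`, and the
g50 seam re-proved from the weaker hypothesis: `SlavedEnvelopeAt η₃ τ ℓ s q → ChartRoom ρ ε η₂ η₃ τ κ κ₁ → EnvelopeCert η₃ κ κ₁ φ ℓ s q → EdgeFarFloor (63/10) (63/10) ρ ε η₂ φ`.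

FLAG-2 (§§2–4, the substantive one: the LINEAR room law `t = κ·windowRoom + κ₁σ₁` of (E2) is load-bearing and UNDECIDED; if score-lowering slaved directions
live in the first-order-NEUTRAL subspace of the window cone, `t ∝ √room` or worse and the linear envelope dies at the edge).  ANALYSIS (memo NODE-g51.md §2,
dimension count): with the exterior beyond `63/10` FREE (as `Admissible`/`EnvChart` leave it), smooth elastically-equilibrated bending modes of the capped
ball are first-order force-free and — for quadratic bending after the three `Γ`-odd conditions, for cubic bending on an open cone — never DEcrease a capped
12-shell misfit at first order; so the cone LP with `u_B` free is predicted UNBOUNDED along smooth modes and NO law `t ≤ T(room, σ₁)` with `T → κ₁σ₁` at the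
edge can hold for charts by HOMOGENEOUS instances: smooth bending of several % is admissible arbitrarily close to the edge host.  What prices smooth bending
is not the window but the MEMBERS' OWN local chart (Cauchy–Born at the 19 members: `S ≈ avg_j W_CB(e_j) + D_j : ∇e`, every `e_j` inside the window, and at
the `S_hom`-minimising edge host the KKT condition `∇W_CB = λΓ` makes the first-order term of every window-admissible smooth mode NON-NEGATIVE up to the
hcp strain-gradient (`D_3h`, piezo-type) column `D:∇e`).  Hence the TWO-SCALE repair typed here: enlarge the CHART FAMILY from homogeneous instances to
BENT instances (a homogeneous instance composed with a map from a parameter class `𝓑`, e.g. near-identity polynomial maps of degree ≤ 3), so that the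
smooth part of the non-affinity is absorbed INTO THE CHART (priced by the certificate over the finite-dimensional bent family, where the instrument of this
generation «BEND51» already probes it) and only the ROUGH remainder is charged to the room law — for which the linear law is the natural conjecture again
(rough boundary modes change capped misfits non-uniformly at first order, so the one-sided windows and the force cap DO bind them linearly).

THE TYPED OBJECT (§2) is the g50 engine with three parameters pulled out: a CHART FAMILY `𝓘 : (M₀ : ℕ) → (Fin M₀ → E3) → Fin M₀ → Prop` (which instances
may serve as charts), an ENVELOPE MODULUS `Φ : … → ℝ → ℝ` (the price of rough deviation `t` at the instance) and a ROOM LAW `T : … → ℝ` (the rough deviation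
a far edge-band cluster needs): (F1) `FamilyEnvelope 𝓘 τ Φ`, (F2) `FamilyRoom 𝓘 ρ ε η₂ τ T`, (F3) `FamilyCert 𝓘 φ Φ T`, SEAM (F1) ∧ (F2) ∧ (F3) ⟹
`EdgeFarFloor (63/10) (63/10) ρ ε η₂ φ` (pure inequalities + isometry invariance of the score), and the ORDER STRUCTURE that states the trade exactly:
(F1) and (F3) are ANTITONE in the family, (F2) is MONOTONE in the family (a richer chart family makes the room law weaker and the envelope/certificate
stronger); (F2) is monotone and (F3) antitone in the law `T` (for moduli monotone in `t`), (F1) monotone and (F3) antitone in the modulus.  §3: g50's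
(E1-At) / (E2) / (E3) ARE the instance (`homFamily η₃`, `lsqModulus ℓ s q`, `linearLaw κ κ₁`) — proved as equivalences — and the ROOT law
`κ·room + κ½·√room + κ₁σ₁` and a constant EXTERIOR-TEXTURE column are further instances (memo FLAG-3: `EnvChart` bounds nothing beyond `63/10`, so (E1)'s tables
carry an implicit supremum over admissible exteriors — typed here as the modulus' `t`-independent part).  §4: `IsBentBall 𝓑 R`, `bentFamily 𝓑 η₃ ⊇ homFamily η₃`
(`id ∈ 𝓑`), hence `FamilyRoom (homFamily η₃) … T → FamilyRoom (bentFamily 𝓑 η₃) … T` and the bent line's (F1)/(F3) imply the homogeneous line's.  §5: the record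
(`ρ = 24/5`, `ε = 1/100`, any `φ₁ ≥ 0`) threaded to `CoreOffTubeFloor (63/10) (63/10) (24/5) (1/100) φ₁` and `StrainedPatchRec` with the [SOFT-FAR] residual of record.
Lean fixes no census number; no new axioms, no cite tokens, no instances / notation.
SPLIT (lens-5 g52, critic ROW 900: 400-line limit): THIS FILE holds §§1–2 (FLAG-1 and the parametric engine with its order structure); §§3–5
(instances, bent families, record) are the sequel `…StrainedPatchChartFamiliesBent`, decl text unchanged.
-/

namespace Summit.AtomisticToContinuum.Crystallization.Theorems.FrustratedLawDichotomyStrainedPatchChartFamilies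
open Summit.AtomisticToContinuum.Crystallization.Theorems.FrustratedLawDichotomyPeriodicBlockFlags (goodAtScale_mono)

open scoped BigOperators Classical
open Summit.AtomisticToContinuum.Crystallization.Theorems.FrustratedLawDichotomyMotifLemmas
open Summit.AtomisticToContinuum.Crystallization.Theorems.FrustratedLawDichotomyAveragingCut
open Summit.AtomisticToContinuum.Crystallization.Theorems.FrustratedLawDichotomyAveragingRuleCap
open Summit.AtomisticToContinuum.Crystallization.Theorems.FrustratedLawDichotomyAveragingRuleTightFree
open Summit.AtomisticToContinuum.Crystallization.Theorems.FrustratedLawDichotomyExemptDoor (SitePred)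
open Summit.AtomisticToContinuum.Crystallization.Theorems.FrustratedLawDichotomyExemptAbsorption
open Summit.AtomisticToContinuum.Crystallization.Theorems.FrustratedLawDichotomyExemptAbsorptionRecord
open Summit.AtomisticToContinuum.Crystallization.Theorems.FrustratedLawDichotomyCollarCensus
open Summit.AtomisticToContinuum.Crystallization.Theorems.FrustratedLawDichotomyCollarCensusKappa
open Summit.AtomisticToContinuum.Crystallization.Theorems.FrustratedLawDichotomyStrainedPatchHomSplit
open Summit.AtomisticToContinuum.Crystallization.Theorems.FrustratedLawDichotomyStrainedPatchCleanCollar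
open Summit.AtomisticToContinuum.Crystallization.Theorems.FrustratedLawDichotomyStrainedPatchHomTube
open Summit.AtomisticToContinuum.Crystallization.Theorems.FrustratedLawDichotomyStrainedPatchHomIsometry
open Summit.AtomisticToContinuum.Crystallization.Theorems.FrustratedLawDichotomyStrainedPatchHomTubeIso
open Summit.AtomisticToContinuum.Crystallization.Theorems.FrustratedLawDichotomyStrainedPatchPhaseCut
open Summit.AtomisticToContinuum.Crystallization.Theorems.FrustratedLawDichotomyStrainedPatchCoreTube
open Summit.AtomisticToContinuum.Crystallization.Theorems.FrustratedLawDichotomyStrainedPatchCoreTubeRecord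
open Summit.AtomisticToContinuum.Crystallization.Theorems.FrustratedLawDichotomyStrainedPatchCoreTubeMilli
open Summit.AtomisticToContinuum.Crystallization.Theorems.FrustratedLawDichotomyStrainedPatchStrainBands

/-! ## §1. FLAG-1: the slaved envelope restricted to linearly stable charts -/

/-- **(E1-At) `SlavedEnvelopeAt η₃ τ ℓ s q` [ANALYTIC, on the STABLE range]** — (E1) of g50 asked only of charts by `η₃`-GOOD admissible homogeneous instances
(centre 12-shell misfit below `η₃ < η*`, the instability onset): every admissible record cluster coarsely charted (tolerance `τ`) by such an instance with uncapped
deviation `≤ t` scores at least `S(z₀) − ℓ(z₀)·t − s(z₀)·σ₁ − q(z₀)·t²`. -/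
def SlavedEnvelopeAt (η₃ τ : ℝ) (ℓ s q : (M₀ : ℕ) → (Fin M₀ → E3) → Fin M₀ → ℝ) : Prop :=
  ∀ (M : ℕ) (z : Fin M → E3) (c : Fin M) (M₀ : ℕ) (z₀ : Fin M₀ → E3) (c₀ : Fin M₀) (e : Fin M → Fin M₀) (t : ℝ),
    Admissible M z c → CleanBall (63 / 10) z c → MonoPhaseBall (63 / 10) z c → 0 ≤ t → GoodAtScale η₃ (3 / 2) z₀ c₀ → EnvChart τ t z c z₀ c₀ e →
      ballAvg (9 / 5) z₀ (xRec M₀ z₀) c₀ - ℓ M₀ z₀ c₀ * t - s M₀ z₀ c₀ * sigmaOne - q M₀ z₀ c₀ * t ^ 2 ≤ ballAvg (9 / 5) z (xRec M z) c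

/-- The unrestricted (E1) gives the restricted one at every `η₃`. [formal bookkeeping] -/
theorem slavedEnvelopeAt_of_slavedEnvelope {τ : ℝ} {ℓ s q : (M₀ : ℕ) → (Fin M₀ → E3) → Fin M₀ → ℝ} (η₃ : ℝ) (h : SlavedEnvelope τ ℓ s q) :
    SlavedEnvelopeAt η₃ τ ℓ s q :=
  fun M z c M₀ z₀ c₀ e t hz hcl hm ht _ hch => h M z c M₀ z₀ c₀ e t hz hcl hm ht hch

/-- (E1-At) is ANTITONE in `η₃` (fewer charts to envelope). [folklore] -/
theorem SlavedEnvelopeAt.anti {η₃ η₃' τ : ℝ} {ℓ s q : (M₀ : ℕ) → (Fin M₀ → E3) → Fin M₀ → ℝ} (h : SlavedEnvelopeAt η₃' τ ℓ s q) (hle : η₃ ≤ η₃') :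
    SlavedEnvelopeAt η₃ τ ℓ s q :=
  fun M z c M₀ z₀ c₀ e t hz hcl hm ht hg hch => h M z c M₀ z₀ c₀ e t hz hcl hm ht (goodAtScale_mono hle hg) hch

/-- ★★ THE g50 SEAM FROM THE WEAKER HYPOTHESIS: (E1-At) ∧ (E2) ∧ (E3) ⟹ `EdgeFarFloor (63/10) (63/10) ρ ε η₂ φ` ((E2) delivers `η₃`-good charts). [folklore] -/
theorem edgeFar_of_envelopeAt_of_room_of_cert {ρ ε η₂ η₃ τ κ κ₁ φ : ℝ} {ℓ s q : (M₀ : ℕ) → (Fin M₀ → E3) → Fin M₀ → ℝ}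
    (hE : SlavedEnvelopeAt η₃ τ ℓ s q) (hR : ChartRoom ρ ε η₂ η₃ τ κ κ₁) (hC : EnvelopeCert η₃ κ κ₁ φ ℓ s q) :
    EdgeFarFloor (63 / 10) (63 / 10) ρ ε η₂ φ := by
  intro M z c hz hcl hm hn hg
  obtain ⟨R, M₀, z₀, c₀, e, hg₃, ht, hch⟩ := hR M z c hz hcl hm hn hg
  have h₁ := hE M (⇑R ∘ z) c M₀ z₀ c₀ e _ ((admissible_comp_iff R z c).2 hz) ((cleanBall_comp_iff R z c).2 hcl)
    ((monoPhaseBall_comp_iff R z c).2 hm) ht hg₃ hch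
  rw [ballAvg_xRec_comp] at h₁
  have h₃ := hC M₀ z₀ c₀ hch.1 hch.2.1 hg₃
  linarith

/-- … hence the node and the record of g50 from (E1-At). [folklore] -/
theorem coreOff_of_envelopeAt_of_room_of_cert_of_soft {ρ ε η₂ η₃ τ κ κ₁ φ : ℝ} {ℓ s q : (M₀ : ℕ) → (Fin M₀ → E3) → Fin M₀ → ℝ}
    (hE : SlavedEnvelopeAt η₃ τ ℓ s q) (hR : ChartRoom ρ ε η₂ η₃ τ κ κ₁) (hC : EnvelopeCert η₃ κ κ₁ φ ℓ s q)
    (hS : SoftFarFloor (63 / 10) (63 / 10) ρ ε η₂ φ) : CoreOffTubeFloor (63 / 10) (63 / 10) ρ ε φ :=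
  (coreOff_iff_edge_and_soft _ _ ρ ε η₂ φ).2 ⟨edgeFar_of_envelopeAt_of_room_of_cert hE hR hC, hS⟩

/-! ## §2. The engine parametric in the chart family `𝓘`, the envelope modulus `Φ` and the room law `T` -/

/-- **`ChartBy 𝓘 τ t z c z₀ c₀ e`** — `EnvChart` with the clause «`(z₀, c₀)` is an admissible homogeneous instance» replaced by membership in an arbitrary
CHART FAMILY `𝓘`: `𝓘 M₀ z₀ c₀`, `e` centre to centre, coarse deviation `≤ τ` on the `63/10`-ball, fine deviation `≤ t` on its UNCAPPED part (sites farther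
than `9/2` from every `9/5`-member), `e` injective on the ball and covering the instance's `(63/10 − τ)`-ball. -/
def ChartBy (𝓘 : (M₀ : ℕ) → (Fin M₀ → E3) → Fin M₀ → Prop) (τ t : ℝ) {M : ℕ} (z : Fin M → E3) (c : Fin M) {M₀ : ℕ} (z₀ : Fin M₀ → E3) (c₀ : Fin M₀)
    (e : Fin M → Fin M₀) : Prop :=
  𝓘 M₀ z₀ c₀ ∧ e c = c₀ ∧
    (∀ a, dist (z a) (z c) ≤ 63 / 10 → dist (z a - z c) (z₀ (e a) - z₀ c₀) ≤ τ) ∧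
    (∀ a, dist (z a) (z c) ≤ 63 / 10 → (∀ j, dist (z j) (z c) ≤ 9 / 5 → 9 / 2 < dist (z a) (z j)) → dist (z a - z c) (z₀ (e a) - z₀ c₀) ≤ t) ∧
    (∀ a b, dist (z a) (z c) ≤ 63 / 10 → dist (z b) (z c) ≤ 63 / 10 → e a = e b → a = b) ∧
    (∀ b₀, dist (z₀ b₀) (z₀ c₀) ≤ 63 / 10 - τ → ∃ a, dist (z a) (z c) ≤ 63 / 10 ∧ e a = b₀)

/-- **(F1) `FamilyEnvelope 𝓘 τ Φ` [ANALYTIC]** — every admissible record cluster charted (coarse `τ`, fine `t ≥ 0`) by an instance of the family scores at least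
the instance's score minus the ENVELOPE MODULUS `Φ(z₀)(t)`. -/
def FamilyEnvelope (𝓘 : (M₀ : ℕ) → (Fin M₀ → E3) → Fin M₀ → Prop) (τ : ℝ) (Φ : (M₀ : ℕ) → (Fin M₀ → E3) → Fin M₀ → ℝ → ℝ) : Prop :=
  ∀ (M : ℕ) (z : Fin M → E3) (c : Fin M) (M₀ : ℕ) (z₀ : Fin M₀ → E3) (c₀ : Fin M₀) (e : Fin M → Fin M₀) (t : ℝ),
    Admissible M z c → CleanBall (63 / 10) z c → MonoPhaseBall (63 / 10) z c → 0 ≤ t → ChartBy 𝓘 τ t z c z₀ c₀ e →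
      ballAvg (9 / 5) z₀ (xRec M₀ z₀) c₀ - Φ M₀ z₀ c₀ t ≤ ballAvg (9 / 5) z (xRec M z) c

/-- **(F2) `FamilyRoom 𝓘 ρ ε η₂ τ T` [GEOMETRIC — the ROOM LAW]** — every far-class record cluster whose centre is `η₂`-good admits, modulo a linear isometry,
a chart by an instance of the family with fine deviation the ROOM LAW's value `T(z₀) ≥ 0` at the instance. -/
def FamilyRoom (𝓘 : (M₀ : ℕ) → (Fin M₀ → E3) → Fin M₀ → Prop) (ρ ε η₂ τ : ℝ) (T : (M₀ : ℕ) → (Fin M₀ → E3) → Fin M₀ → ℝ) : Prop :=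
  ∀ (M : ℕ) (z : Fin M → E3) (c : Fin M), Admissible M z c → CleanBall (63 / 10) z c → MonoPhaseBall (63 / 10) z c → ¬NearHomIsoAt ρ ε z c →
    GoodAtScale η₂ (3 / 2) z c →
      ∃ (R : E3 ≃ₗᵢ[ℝ] E3) (M₀ : ℕ) (z₀ : Fin M₀ → E3) (c₀ : Fin M₀) (e : Fin M → Fin M₀),
        0 ≤ T M₀ z₀ c₀ ∧ ChartBy 𝓘 τ (T M₀ z₀ c₀) (⇑R ∘ z) c z₀ c₀ e

/-- **(F3) `FamilyCert 𝓘 φ Φ T` [CERTIFICATE over the family, INSTRUMENTABLE]** — on every instance of the family the enveloped score at the room law's deviation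
clears the floor: `φ ≤ S(z₀) − Φ(z₀)(T(z₀))`. -/
def FamilyCert (𝓘 : (M₀ : ℕ) → (Fin M₀ → E3) → Fin M₀ → Prop) (φ : ℝ) (Φ : (M₀ : ℕ) → (Fin M₀ → E3) → Fin M₀ → ℝ → ℝ)
    (T : (M₀ : ℕ) → (Fin M₀ → E3) → Fin M₀ → ℝ) : Prop :=
  ∀ (M₀ : ℕ) (z₀ : Fin M₀ → E3) (c₀ : Fin M₀), 𝓘 M₀ z₀ c₀ → φ ≤ ballAvg (9 / 5) z₀ (xRec M₀ z₀) c₀ - Φ M₀ z₀ c₀ (T M₀ z₀ c₀)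

/-- ★★ THE PARAMETRIC SEAM: (F1) ∧ (F2) ∧ (F3) ⟹ `EdgeFarFloor (63/10) (63/10) ρ ε η₂ φ` — chart the rotated cluster, envelope it, certify the chart; the score is
isometry invariant.  Every family, modulus and law. [folklore] -/
theorem edgeFar_of_family {𝓘 : (M₀ : ℕ) → (Fin M₀ → E3) → Fin M₀ → Prop} {ρ ε η₂ τ φ : ℝ} {Φ : (M₀ : ℕ) → (Fin M₀ → E3) → Fin M₀ → ℝ → ℝ}
    {T : (M₀ : ℕ) → (Fin M₀ → E3) → Fin M₀ → ℝ} (hE : FamilyEnvelope 𝓘 τ Φ) (hR : FamilyRoom 𝓘 ρ ε η₂ τ T) (hC : FamilyCert 𝓘 φ Φ T) :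
    EdgeFarFloor (63 / 10) (63 / 10) ρ ε η₂ φ := by
  intro M z c hz hcl hm hn hg
  obtain ⟨R, M₀, z₀, c₀, e, ht, hch⟩ := hR M z c hz hcl hm hn hg
  have h₁ := hE M (⇑R ∘ z) c M₀ z₀ c₀ e _ ((admissible_comp_iff R z c).2 hz) ((cleanBall_comp_iff R z c).2 hcl)
    ((monoPhaseBall_comp_iff R z c).2 hm) ht hch
  rw [ballAvg_xRec_comp] at h₁
  have h₃ := hC M₀ z₀ c₀ hch.1
  linarith

/-- ★★ THE PARAMETRIC NODE: (F1) ∧ (F2) ∧ (F3) ∧ `SoftFarFloor (63/10) (63/10) ρ ε η₂ φ` [RESIDUAL of record] ⟹ `CoreOffTubeFloor (63/10) (63/10) ρ ε φ`. [folklore] -/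
theorem coreOff_of_family_of_soft {𝓘 : (M₀ : ℕ) → (Fin M₀ → E3) → Fin M₀ → Prop} {ρ ε η₂ τ φ : ℝ} {Φ : (M₀ : ℕ) → (Fin M₀ → E3) → Fin M₀ → ℝ → ℝ}
    {T : (M₀ : ℕ) → (Fin M₀ → E3) → Fin M₀ → ℝ} (hE : FamilyEnvelope 𝓘 τ Φ) (hR : FamilyRoom 𝓘 ρ ε η₂ τ T) (hC : FamilyCert 𝓘 φ Φ T)
    (hS : SoftFarFloor (63 / 10) (63 / 10) ρ ε η₂ φ) : CoreOffTubeFloor (63 / 10) (63 / 10) ρ ε φ :=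
  (coreOff_iff_edge_and_soft _ _ ρ ε η₂ φ).2 ⟨edgeFar_of_family hE hR hC, hS⟩

/-! ### The order structure: the trade between chart family, room law and modulus, stated exactly -/

/-- `FamilyLE 𝓘 𝓘'` — the family `𝓘` is contained in `𝓘'`. -/
def FamilyLE (𝓘 𝓘' : (M₀ : ℕ) → (Fin M₀ → E3) → Fin M₀ → Prop) : Prop :=
  ∀ (M₀ : ℕ) (z₀ : Fin M₀ → E3) (c₀ : Fin M₀), 𝓘 M₀ z₀ c₀ → 𝓘' M₀ z₀ c₀

/-- Auxiliary step (`familyLE refl`). [formal bookkeeping] -/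
theorem familyLE_refl (𝓘 : (M₀ : ℕ) → (Fin M₀ → E3) → Fin M₀ → Prop) : FamilyLE 𝓘 𝓘 := fun _ _ _ h => h

/-- Auxiliary step (`trans`). [formal bookkeeping] -/
theorem FamilyLE.trans {𝓘 𝓘' 𝓘'' : (M₀ : ℕ) → (Fin M₀ → E3) → Fin M₀ → Prop} (h : FamilyLE 𝓘 𝓘') (h' : FamilyLE 𝓘' 𝓘'') : FamilyLE 𝓘 𝓘'' :=
  fun M₀ z₀ c₀ hI => h' M₀ z₀ c₀ (h M₀ z₀ c₀ hI)

/-- A chart by a member of a smaller family is a chart by a member of the larger. [formal bookkeeping] -/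
theorem ChartBy.mono_family {𝓘 𝓘' : (M₀ : ℕ) → (Fin M₀ → E3) → Fin M₀ → Prop} {τ t : ℝ} {M : ℕ} {z : Fin M → E3} {c : Fin M} {M₀ : ℕ}
    {z₀ : Fin M₀ → E3} {c₀ : Fin M₀} {e : Fin M → Fin M₀} (h : ChartBy 𝓘 τ t z c z₀ c₀ e) (hle : FamilyLE 𝓘 𝓘') : ChartBy 𝓘' τ t z c z₀ c₀ e :=
  ⟨hle M₀ z₀ c₀ h.1, h.2⟩

/-- The fine clause loosens with `t`. [formal bookkeeping] -/
theorem ChartBy.mono_t {𝓘 : (M₀ : ℕ) → (Fin M₀ → E3) → Fin M₀ → Prop} {τ t t' : ℝ} {M : ℕ} {z : Fin M → E3} {c : Fin M} {M₀ : ℕ}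
    {z₀ : Fin M₀ → E3} {c₀ : Fin M₀} {e : Fin M → Fin M₀} (h : ChartBy 𝓘 τ t z c z₀ c₀ e) (hle : t ≤ t') : ChartBy 𝓘 τ t' z c z₀ c₀ e :=
  ⟨h.1, h.2.1, h.2.2.1, fun a ha hu => (h.2.2.2.1 a ha hu).trans hle, h.2.2.2.2⟩

/-- ★ (F1) is ANTITONE in the family: enveloping a richer family envelopes the poorer. [folklore] -/
theorem FamilyEnvelope.anti_family {𝓘 𝓘' : (M₀ : ℕ) → (Fin M₀ → E3) → Fin M₀ → Prop} {τ : ℝ} {Φ : (M₀ : ℕ) → (Fin M₀ → E3) → Fin M₀ → ℝ → ℝ}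
    (h : FamilyEnvelope 𝓘' τ Φ) (hle : FamilyLE 𝓘 𝓘') : FamilyEnvelope 𝓘 τ Φ :=
  fun M z c M₀ z₀ c₀ e t hz hcl hm ht hch => h M z c M₀ z₀ c₀ e t hz hcl hm ht (hch.mono_family hle)

/-- ★ (F3) is ANTITONE in the family: certifying a richer family certifies the poorer. [folklore] -/
theorem FamilyCert.anti_family {𝓘 𝓘' : (M₀ : ℕ) → (Fin M₀ → E3) → Fin M₀ → Prop} {φ : ℝ} {Φ : (M₀ : ℕ) → (Fin M₀ → E3) → Fin M₀ → ℝ → ℝ}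
    {T : (M₀ : ℕ) → (Fin M₀ → E3) → Fin M₀ → ℝ} (h : FamilyCert 𝓘' φ Φ T) (hle : FamilyLE 𝓘 𝓘') : FamilyCert 𝓘 φ Φ T :=
  fun M₀ z₀ c₀ hI => h M₀ z₀ c₀ (hle M₀ z₀ c₀ hI)

/-- ★ (F2) is MONOTONE in the family: a richer chart family makes the room law easier to meet. [folklore] -/
theorem FamilyRoom.mono_family {𝓘 𝓘' : (M₀ : ℕ) → (Fin M₀ → E3) → Fin M₀ → Prop} {ρ ε η₂ τ : ℝ} {T : (M₀ : ℕ) → (Fin M₀ → E3) → Fin M₀ → ℝ}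
    (h : FamilyRoom 𝓘 ρ ε η₂ τ T) (hle : FamilyLE 𝓘 𝓘') : FamilyRoom 𝓘' ρ ε η₂ τ T := by
  intro M z c hz hcl hm hn hg
  obtain ⟨R, M₀, z₀, c₀, e, ht, hch⟩ := h M z c hz hcl hm hn hg
  exact ⟨R, M₀, z₀, c₀, e, ht, hch.mono_family hle⟩

/-- (F2) is MONOTONE in the room law (pointwise). [formal bookkeeping] -/
theorem FamilyRoom.mono_law {𝓘 : (M₀ : ℕ) → (Fin M₀ → E3) → Fin M₀ → Prop} {ρ ε η₂ τ : ℝ} {T T' : (M₀ : ℕ) → (Fin M₀ → E3) → Fin M₀ → ℝ}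
    (h : FamilyRoom 𝓘 ρ ε η₂ τ T) (hle : ∀ (M₀ : ℕ) (z₀ : Fin M₀ → E3) (c₀ : Fin M₀), T M₀ z₀ c₀ ≤ T' M₀ z₀ c₀) : FamilyRoom 𝓘 ρ ε η₂ τ T' := by
  intro M z c hz hcl hm hn hg
  obtain ⟨R, M₀, z₀, c₀, e, ht, hch⟩ := h M z c hz hcl hm hn hg
  exact ⟨R, M₀, z₀, c₀, e, ht.trans (hle M₀ z₀ c₀), hch.mono_t (hle M₀ z₀ c₀)⟩

/-- (F3) is ANTITONE in the room law for moduli monotone in the deviation. [formal bookkeeping] -/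
theorem FamilyCert.anti_law {𝓘 : (M₀ : ℕ) → (Fin M₀ → E3) → Fin M₀ → Prop} {φ : ℝ} {Φ : (M₀ : ℕ) → (Fin M₀ → E3) → Fin M₀ → ℝ → ℝ}
    {T T' : (M₀ : ℕ) → (Fin M₀ → E3) → Fin M₀ → ℝ} (h : FamilyCert 𝓘 φ Φ T')
    (hΦ : ∀ (M₀ : ℕ) (z₀ : Fin M₀ → E3) (c₀ : Fin M₀), Monotone (Φ M₀ z₀ c₀))
    (hle : ∀ (M₀ : ℕ) (z₀ : Fin M₀ → E3) (c₀ : Fin M₀), T M₀ z₀ c₀ ≤ T' M₀ z₀ c₀) : FamilyCert 𝓘 φ Φ T := by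
  intro M₀ z₀ c₀ hI
  have h₁ := h M₀ z₀ c₀ hI
  have h₂ := hΦ M₀ z₀ c₀ (hle M₀ z₀ c₀)
  linarith

/-- (F1) is MONOTONE in the modulus (a larger price is easier to prove) … [formal bookkeeping] -/
theorem FamilyEnvelope.mono_modulus {𝓘 : (M₀ : ℕ) → (Fin M₀ → E3) → Fin M₀ → Prop} {τ : ℝ} {Φ Φ' : (M₀ : ℕ) → (Fin M₀ → E3) → Fin M₀ → ℝ → ℝ}
    (h : FamilyEnvelope 𝓘 τ Φ) (hle : ∀ (M₀ : ℕ) (z₀ : Fin M₀ → E3) (c₀ : Fin M₀) (t : ℝ), 0 ≤ t → Φ M₀ z₀ c₀ t ≤ Φ' M₀ z₀ c₀ t) :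
    FamilyEnvelope 𝓘 τ Φ' := by
  intro M z c M₀ z₀ c₀ e t hz hcl hm ht hch
  have h₁ := h M z c M₀ z₀ c₀ e t hz hcl hm ht hch
  have h₂ := hle M₀ z₀ c₀ t ht
  linarith

/-- … and (F3) ANTITONE in the modulus (at laws with non-negative values on the family). [formal bookkeeping] -/
theorem FamilyCert.anti_modulus {𝓘 : (M₀ : ℕ) → (Fin M₀ → E3) → Fin M₀ → Prop} {φ : ℝ} {Φ Φ' : (M₀ : ℕ) → (Fin M₀ → E3) → Fin M₀ → ℝ → ℝ}
    {T : (M₀ : ℕ) → (Fin M₀ → E3) → Fin M₀ → ℝ} (h : FamilyCert 𝓘 φ Φ' T)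
    (hT : ∀ (M₀ : ℕ) (z₀ : Fin M₀ → E3) (c₀ : Fin M₀), 𝓘 M₀ z₀ c₀ → 0 ≤ T M₀ z₀ c₀)
    (hle : ∀ (M₀ : ℕ) (z₀ : Fin M₀ → E3) (c₀ : Fin M₀) (t : ℝ), 0 ≤ t → Φ M₀ z₀ c₀ t ≤ Φ' M₀ z₀ c₀ t) : FamilyCert 𝓘 φ Φ T := by
  intro M₀ z₀ c₀ hI
  have h₁ := h M₀ z₀ c₀ hI
  have h₂ := hle M₀ z₀ c₀ _ (hT M₀ z₀ c₀ hI)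
  linarith

/-- (F2) is antitone in `η₂` and transfers down the core-radius ladder / up the tube width; (F1),(F2),(F3) are antitone in `φ` where `φ` occurs. [formal bookkeeping] -/
theorem FamilyRoom.anti {𝓘 : (M₀ : ℕ) → (Fin M₀ → E3) → Fin M₀ → Prop} {ρ ε η₂ η₂' τ : ℝ} {T : (M₀ : ℕ) → (Fin M₀ → E3) → Fin M₀ → ℝ}
    (h : FamilyRoom 𝓘 ρ ε η₂' τ T) (hle : η₂ ≤ η₂') : FamilyRoom 𝓘 ρ ε η₂ τ T :=
  fun M z c hz hcl hm hn hg => h M z c hz hcl hm hn (goodAtScale_mono hle hg)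

/-- `FamilyRoom` is monotone in its tolerance. [formal bookkeeping] -/
theorem FamilyRoom.of_le {𝓘 : (M₀ : ℕ) → (Fin M₀ → E3) → Fin M₀ → Prop} {ρ ρ' ε ε' η₂ τ : ℝ} {T : (M₀ : ℕ) → (Fin M₀ → E3) → Fin M₀ → ℝ}
    (h : FamilyRoom 𝓘 ρ' ε' η₂ τ T) (hρ : ρ ≤ ρ') (hε : ε' ≤ ε) : FamilyRoom 𝓘 ρ ε η₂ τ T :=
  fun M z c hz hcl hm hn hg => h M z c hz hcl hm (fun hn' => hn ((hn'.of_le_radius hρ).mono hε)) hg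

/-- `FamilyCert` is monotone in its tolerance. [formal bookkeeping] -/
theorem FamilyCert.of_le {𝓘 : (M₀ : ℕ) → (Fin M₀ → E3) → Fin M₀ → Prop} {φ φ' : ℝ} {Φ : (M₀ : ℕ) → (Fin M₀ → E3) → Fin M₀ → ℝ → ℝ}
    {T : (M₀ : ℕ) → (Fin M₀ → E3) → Fin M₀ → ℝ} (h : FamilyCert 𝓘 φ Φ T) (hle : φ' ≤ φ) : FamilyCert 𝓘 φ' Φ T :=
  fun M₀ z₀ c₀ hI => hle.trans (h M₀ z₀ c₀ hI)

end Summit.AtomisticToContinuum.Crystallization.Theorems.FrustratedLawDichotomyStrainedPatchChartFamilies
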